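import Summits.NavierStokesRegularity.OSWSelfSimilar.SheetRLinearisedStabilityEvenEndToEnd
import Summits.NavierStokesRegularity.OSWSelfSimilar.SheetRSpectrumEvenOfRecord
import Summits.NavierStokesRegularity.OSWSelfSimilar.SheetRLiftEvenOfRecordSmooth
import HarnessLib

/-!
# Sheet-ℝ spectral certificate (Z3-SR-SPEC, EVEN half): «LINEARLY STABLE MODULO TRANSLATION» FOR THE OBJECTS OF RECORD — cert-1 g10's
# `flow_stable_even_of_centre_of_smooth` at the centre of record `centreOfRecord`, THE certified `δ`, and the even lift of record `liftEOfRecord`,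
# modulo the SAME SEVEN named interval sentences as the even spectral word of record, and NO domain / regularity binder

HONEST FRAMING (cell ns-blowup GROUP B «PROFILE SEARCH»; PROFILE-SPEC v1.3 cases Z3-SR-CERT + Z3-SR-SPEC EVEN half, HYPOTHESIS-LEDGER v2.4 row (P10)⁺, ofRecord
half; 1-D MODEL (viscous gCLM/OSW sheet on `ℝ` at `(a, c_l, ε) = (1/5, 1/2, 1)`, frame `L = 8`, `λ = θ = 4`); computer-assisted; not Euler/NS; «violates: none —
MODEL»).  Nothing here is a statement about Navier–Stokes; NO enclosure and NO datum is proved here — pure composition (seat ns-blowup-profile-cert-5 g11, item (E3b) of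
profile-lead (mz)), the (P10)⁺ twin of this seat's `SheetRSpectrumEvenOfRecord.eigen_set_eq_singleton_ofRecord` (p561991):
cert-1 g10's (B′) `SheetRLinearisedStabilityEvenEndToEnd.flow_stable_even_of_centre_of_smooth` speaks about a centre datum `hc`, a profile `Ω*` given by
`hcs : IsCentre 8 Ω* Ω*₁ H*`, `Ω* = Ω̄ + prim (der u)` with `‖u‖_E ≤ rE♯₂`, the weak zero `hweak` with `Ω*(X₀) ≠ 0`, an even zero-mass lift `h⁺ ∈ WevenZ` with
`‖h⁺ + 0i‖² ≤ hw2E`, an instance `[CompleteSpace (WcevenZ h8)]`, and — the regularity price of the (P10)⁺ word — a `C²` representative `φ` of `h⁺` (even, `∫φ = 0`)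
with the four weights `∫w φ², ∫w φ′², ∫w (ξφ′)², ∫w φ″² < ∞`.  This file DISCHARGES all of these for THE OBJECTS OF RECORD, exactly as (E2) did for the spectral
word, plus the regularity price by this seat's calculus file (E3a) `SheetRLiftEvenOfRecordSmooth` (p567454):
* `Ω̄ := centreOfRecord` (`isCentre_centreOfRecord`), `u := δ` = THE certified correction of `SheetRNewtonKantorovichOfRecord.existsUnique_weakSolution_ofRecord`
  (modulo NK #5 #6 #7 #8b), `(Ω*₁, H*, hcs, hweak, Ω*(8) ≠ 0)` := cert-2 g8's `exists_isCentre_star`, `hu` := `rEBR2 ≤ rE♯₂`, `hsum := rfl`;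
* `h⁺ := liftEOfRecord` (rows 14⁺/13⁺: `liftEOfRecord_mem_WevenZ`, `norm_sq_realE_liftEOfRecord_le`), `φ := liftFunE` with `contDiff_liftFunE`, `liftFunE_neg`,
  `integrable_liftFunE_and_integral.2`, `integrable_weight_liftFunE_sq` (E1) and the three weights `integrable_weight_deriv_liftFunE_sq`,
  `integrable_weight_mul_deriv_liftFunE_sq`, `integrable_weight_deriv_deriv_liftFunE_sq` (E3a), `hEφ := liftEOfRecord_ae_and_norm.1`;
* `[CompleteSpace (WcevenZ _)]` := `completeSpace_WcevenZ` (discharged inside; no instance binder, no instance declaration);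
* the (S1⁺) datum := `gardingDataKE_ofRecord hS1` (row 10⁺ trimmed to the bare even Gårding inequality), `hc2`/`hm` := `c2_le_fifth`/`c1_add_gamma_le`.
RESULTS: §1 **`liftEOfRecord_mem_domain_generatorEven`** — `h⁺ + 0i ∈ D(T⁺)` for EVERY (S1⁺) datum `(d, V, K)` on the frame `L = 8` and EVERY base point
(cert-1's `realE_mem_domain_generatorEven_of_smooth` fed by (E1)/(E3a)): the binder `hf`/`hdom` of the (P10)⁺ word is a THEOREM for the lift of record;
§2 **`flow_stable_even_ofRecord`** — under EXACTLY the SEVEN named hypotheses of the even spectral word of record (#5 `f ℓ Nmat hN₁ hN₂` · #6 `hKNwB` · #7 `hepsNB` ·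
#8b `hηB` · 10⁺ `hS1` · 11⁺ `hPD` · 12⁺ `hFD`) and for every `β′ ∈ (0, 3/100)`: there is exactly one `δ` in the `rEBR2`-ball solving the linearised weak equation at
`centreOfRecord`, and for `Ω* = centreOfRecord + prim (der δ)` (a centre), `T⁺* := generatorEven` at the derived datum `gardingDataKE_star_of_centre` (constants
`(1/5 − Δ⁺, 3/20 − Δ⁺/4)`), `R⁺* := resolventEven` there, `E⁺* := evansEven … ⟪h⁺+0i,·⟫ (h⁺+0i) 4`: **the linearised even flow `S_F = e^{t(T⁺* + 4⟪h⁺+0i,·⟫(h⁺+0i))}` of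
`−DG⁺(Ω*)|E⁺₀` EXISTS (C₀-semigroup; with the coercive semigroup `S` of `T⁺*`, `‖S(τ)‖ ≤ e^{−(3/20−Δ⁺/4)τ}`, Laplace transform `R⁺*`) and every orbit satisfies
`‖S_F(t)δ₀ − (4⟪h⁺+0i, R⁺*(½)δ₀⟫/E⁺*′(½))·e^{t/2}·R⁺*(½)(h⁺+0i)‖ ≤ M‖δ₀‖e^{−β′t}`** — «LINEARLY STABLE MODULO TRANSLATION (MODEL)» for the objects of record, with NO domain,
regularity or data-shape hypothesis; the same count and tier as the even spectral word b6.  No definition, no named fact, no instance, no notation.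
WHAT THIS IS NOT: not NS; not a proof that the seven records hold; no number of record moves; no census word is asserted by this file.
-/

noncomputable section

namespace Summit.NavierStokesRegularity.OSWSelfSimilar
namespace SheetRLinearisedStabilityEvenOfRecord

open _root_.MeasureTheory _root_.Set _root_.Filter _root_.Real _root_.Metric Literature.Analysis.Fourier Literature.Analysis.OperatorTheory
  Literature.Analysis.UnboundedOperators
  SheetRWeakProfilePV SheetRWeakToStrong SheetREnergyClass SheetRWeightedMeasure SheetREnergySpace SheetRLinearisedTests SheetRTestSpace
  SheetRLinearisedFormBounds SheetRSolutionOperator SheetRComplexPivot SheetRAssemblyOperators SheetRCertificateAssembly SheetRCertificateCoercivity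
  SheetRCertificateAssemblyB SheetRSpectrumCertifiedProfile SheetRFrameCentre SheetRCentreOfRecord SheetRCentreOfRecordValue SheetRFrameCentreResidual
  SheetRPointwiseDatumOfRecord SheetRCertifiedProfileOfRecordSeven SheetRNewtonKantorovichOfRecord SheetREvenTests SheetREvenEnergySpace SheetREvenForms
  SheetREvenPairUniqueness SheetREvenResolvent SheetREvenClass SheetRResolventEvenClass SheetRGeneratorEvenWeak SheetREvansEven SheetREvenAssemblyOperators
  SheetREvenSecondVariation SheetREvenEnergySpaceOf SheetRTranslationModeWeakEigen SheetREvenCentreReencoding SheetREvenLinearisationPerturbation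
  SheetRSpectrumStepRule SheetRSpectrumEvenWindingLists SheetRSpectrumEvenPointCertificate SheetRSpectrumEvenPointAssembly SheetRSpectrumEvenAssembly
  SheetRResolventEvenConj SheetRSpectrumEvenEndToEnd SheetRLiftEvenOfRecord SheetRLiftEvenOfRecordSmooth SheetRGeneratorBasePoint
  SheetRLinearisedSemigroup SheetRLinearisedSemigroupEven SheetRLinearisedStabilityEven SheetRLinearisedStabilityEvenRecord SheetRGeneratorEvenSmoothDomain
  SheetRLinearisedStabilityEvenEndToEnd SheetRSpectrumEvenOfRecord Complex CertificateViscousSheetR Matrix Finset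
open scoped Topology ENNReal ContDiff InnerProductSpace BigOperators NNReal

open CertificateViscousSheetRSpectrum (c1 c2 gamma)
open CertificateViscousSheetRSpectrumEven (DeltaE hw2E)

/-! ### §1 The domain binder of the (P10)⁺ word is a theorem for the lift of record -/

/-- **`h⁺ + 0i ∈ D(T⁺)` FOR THE EVEN LIFT OF RECORD, for EVERY (S1⁺) datum and EVERY base point.**  For any drift/potential `d, V`, any bounded
`K : EspE 8 → L²_w` and any even Gårding datum `h : GardingDataKE 8 _ d V K D₀ D₁ V₀ c m`, and any `σ₀` with `−m < Re σ₀`: the class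
`realE _ liftEOfRecord _` lies in the domain of Kato's closed operator `generatorEven _ K h σ₀ _` — cert-1 g10's `realE_mem_domain_generatorEven_of_smooth` at
`φ := liftFunE` (C^∞, even, zero mass, the four weights: `SheetRLiftEvenOfRecord` + `SheetRLiftEvenOfRecordSmooth`).  MODEL statement; not NS. [folklore] -/
theorem liftEOfRecord_mem_domain_generatorEven {d V : ℝ → ℝ} {D₀ D₁ V₀ c m : ℝ} (K : EspE 8 eight_pos →L[ℝ] W 8)
    (h : GardingDataKE 8 eight_pos d V K D₀ D₁ V₀ c m) {σ₀ : ℂ} (hσ₀ : -m < σ₀.re) :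
    realE eight_pos liftEOfRecord (liftEOfRecord_mem_WevenZ eight_pos) ∈ (generatorEven eight_pos K h σ₀ hσ₀).domain :=
  realE_mem_domain_generatorEven_of_smooth eight_pos K h hσ₀ contDiff_liftFunE liftFunE_neg integrable_liftFunE_and_integral.2
    integrable_weight_liftFunE_sq integrable_weight_deriv_liftFunE_sq integrable_weight_mul_deriv_liftFunE_sq integrable_weight_deriv_deriv_liftFunE_sq
    liftEOfRecord_ae_and_norm.1 (liftEOfRecord_mem_WevenZ eight_pos)

/-- The same at the eigen-equation base point `σ₀ = 1/2` (the shape of the binder `hdom` of `flow_stable_even_of_centre` / `hf` of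
`exists_flow_sub_translationMode_le_of_pointDataE`), for any datum with `−m < 1/2`.  MODEL statement; not NS. [folklore] -/
theorem liftEOfRecord_mem_domain_generatorEven_half {d V : ℝ → ℝ} {D₀ D₁ V₀ c m : ℝ} (K : EspE 8 eight_pos →L[ℝ] W 8)
    (h : GardingDataKE 8 eight_pos d V K D₀ D₁ V₀ c m) (hm : -m < ((1 : ℂ) / 2).re) :
    realE eight_pos liftEOfRecord (liftEOfRecord_mem_WevenZ eight_pos) ∈ (generatorEven eight_pos K h ((1 : ℂ) / 2) hm).domain :=
  liftEOfRecord_mem_domain_generatorEven K h hm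

/-! ### §2 The (P10)⁺ word for the objects of record -/

section Word

variable {n : ℕ} (f : Fin n → W 8) (ℓ : Fin n → Esp 8 eight_pos →L[ℝ] ℝ) (Nmat : Matrix (Fin n) (Fin n) ℝ)
  (hN₁ : (1 - capMatrix (fun i => baseSolutionOperator (f i)) ℓ) * Nmat = 1)
  (hN₂ : Nmat * (1 - capMatrix (fun i => baseSolutionOperator (f i)) ℓ) = 1)
  (hKNwB : ∀ g : W 8, ‖capInverse (fun i => baseSolutionOperator (f i)) ℓ Nmat (baseSolutionOperator g)‖ ≤ (KNwB : ℝ) * ‖g‖)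
  (hepsNB : ∀ u : Esp 8 eight_pos, ‖PopC eight_pos 4 (1 / 5) isCentre_centreOfRecord u - ∑ i, ℓ i u • f i‖ ≤ (epsNBR : ℝ) * ‖u‖)
  (hηB : Real.sqrt (∫ y, ((8:ℝ) ^ 2 + y ^ 2) * (centreOfRecord y + 1 / 2 * y * centreOfRecordDeriv y
    + 1 / 5 * (∫ s in (0 : ℝ)..y, hilbertTransform centreOfRecord s) * centreOfRecordDeriv y
    - hilbertTransform centreOfRecord y * centreOfRecord y - deriv centreOfRecordDeriv y) ^ 2) ≤ (etaB2 : ℝ))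
  (hS1 : ∀ vp : testSpaceE0,
    1 / 5 * (∫ ξ, ((8:ℝ) ^ 2 + ξ ^ 2) * vp.1.2 ξ ^ 2) + 3 / 20 * ∫ ξ, ((8:ℝ) ^ 2 + ξ ^ 2) * vp.1.1 ξ ^ 2 ≤
      linForm 8 (drift (1 / 5) centreOfRecord) (potential 8 4 centreOfRecord) vp.1.1 vp.1.2 vp.1.1 vp.1.2
        + ∫ y, ((8:ℝ) ^ 2 + y ^ 2) *
          ((((-PopCE eight_pos 4 (1 / 5) isCentre_centreOfRecord
              + ((4 : ℝ) • ((innerSL ℝ liftEOfRecord).comp (ιEE eight_pos))).smulRight liftEOfRecord) (jmapE eight_pos vp) : W 8) : ℝ → ℝ) y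
            * vp.1.1 y))
  (hPD : haveI := completeSpace_WcevenZ eight_pos
    PointDataE (resolventEven eight_pos _ (gardingDataKE_ofRecord hS1))
      (realE eight_pos liftEOfRecord (liftEOfRecord_mem_WevenZ eight_pos)) (realE eight_pos liftEOfRecord (liftEOfRecord_mem_WevenZ eight_pos)) 4
      (evansEven eight_pos _ (gardingDataKE_ofRecord hS1) (innerSL ℂ (realE eight_pos liftEOfRecord (liftEOfRecord_mem_WevenZ eight_pos)))
        (realE eight_pos liftEOfRecord (liftEOfRecord_mem_WevenZ eight_pos)) 4))
  (hFD : haveI := completeSpace_WcevenZ eight_pos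
    MixedFarDatum (resolventEven eight_pos _ (gardingDataKE_ofRecord hS1))
      (realE eight_pos liftEOfRecord (liftEOfRecord_mem_WevenZ eight_pos)) (realE eight_pos liftEOfRecord (liftEOfRecord_mem_WevenZ eight_pos)) 1
      ((10075811313 : ℝ) / 10000000000) ((754639259 : ℝ) / 200000000) ((1011518153 : ℝ) / 250000000) ((4049925993 : ℝ) / 1000000000))

include hN₁ hN₂ hKNwB hepsNB hηB hPD hFD in
/-- **Z3-SR-SPEC EVEN HALF, (P10)⁺ «LINEARLY STABLE MODULO TRANSLATION» FOR THE OBJECTS OF RECORD.**  Frame `L = 8`, `a = 1/5`, `λ = θ = 4`, `β₀ = 3/100`;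
`h⁺ := liftEOfRecord`, `Ω̄ := centreOfRecord`.  Under EXACTLY the seven named hypotheses of the even spectral word of record (module docstring) and for every
`0 < β′ < 3/100`: there is exactly one `δ` in the `rEBR2`-ball solving the linearised weak equation at `centreOfRecord`, and for `Ω* = centreOfRecord + prim (der δ)`
— a centre, `IsCentre 8 Ω* Ω*₁ H*`, with `‖δ‖_E ≤ rE♯₂` — and `T⁺* := generatorEven` at the derived datum `gardingDataKE_star_of_centre` (constants
`(1/5 − Δ⁺, 3/20 − Δ⁺/4)`), `R⁺* := resolventEven` there, `E⁺* := evansEven … ⟪h⁺+0i,·⟫ (h⁺+0i) 4`: C₀-semigroups `S` (generator `T⁺*`, `‖S(τ)‖ ≤ e^{−(3/20−Δ⁺/4)τ}`,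
Laplace transform `R⁺*`) and `S_F` (generator `T⁺* + 4⟪h⁺+0i,·⟫(h⁺+0i)` on `D(T⁺*)`, i.e. `−DG⁺(Ω*)|E⁺₀` in the dictionary) EXIST, and
`‖S_F(t)δ₀ − (4⟪h⁺+0i, R⁺*(½)δ₀⟫/E⁺*′(½))·e^{t/2}·R⁺*(½)(h⁺+0i)‖ ≤ M‖δ₀‖e^{−β′t}` for all `δ₀`, `t ≥ 0`.  The regularity price `h⁺+0i ∈ D(T⁺*)` of the
interface word is PAID here (`liftFunE` is `C^∞` with the four weights), not assumed.  MODEL statement; not NS; nothing is asserted to hold. [folklore] -/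
theorem flow_stable_even_ofRecord {β' : ℝ} (hβ' : 0 < β') (hβ'3 : β' < (3 : ℝ) / 100) :
    haveI := completeSpace_WcevenZ eight_pos
    ∃ δ : Esp 8 eight_pos, δ ∈ closedBall (0 : Esp 8 eight_pos) (rEBR2 : ℝ) ∧
      (∀ v v₁ : ℝ → ℝ, IsCompactTest v v₁ →
        linForm 8 (drift (1 / 5) centreOfRecord) (potential 8 4 centreOfRecord) (prim (der δ)) (der δ) v v₁ =
          ∫ y, ((8:ℝ) ^ 2 + y ^ 2) * ((PopFun 8 4 (1 / 5) centreOfRecord centreOfRecordDeriv δ y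
            - (centreOfRecord y + 1 / 2 * y * centreOfRecordDeriv y
              + 1 / 5 * (∫ s in (0 : ℝ)..y, hilbertTransform centreOfRecord s) * centreOfRecordDeriv y
              - hilbertTransform centreOfRecord y * centreOfRecord y - deriv centreOfRecordDeriv y)
            - QFun 8 (1 / 5) δ δ y) * v y)) ∧
      (∀ δ' ∈ closedBall (0 : Esp 8 eight_pos) (rEBR2 : ℝ),
        (∀ v v₁ : ℝ → ℝ, IsCompactTest v v₁ →
          linForm 8 (drift (1 / 5) centreOfRecord) (potential 8 4 centreOfRecord) (prim (der δ')) (der δ') v v₁ =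
            ∫ y, ((8:ℝ) ^ 2 + y ^ 2) * ((PopFun 8 4 (1 / 5) centreOfRecord centreOfRecordDeriv δ' y
              - (centreOfRecord y + 1 / 2 * y * centreOfRecordDeriv y
                + 1 / 5 * (∫ s in (0 : ℝ)..y, hilbertTransform centreOfRecord s) * centreOfRecordDeriv y
                - hilbertTransform centreOfRecord y * centreOfRecord y - deriv centreOfRecordDeriv y)
              - QFun 8 (1 / 5) δ' δ' y) * v y)) → δ' = δ) ∧
      ∃ (Ωs₁ : ℝ → ℝ) (Hs : ℝ) (hcs : IsCentre 8 (fun y => centreOfRecord y + prim (der δ) y) Ωs₁ Hs) (hu : ‖δ‖ ≤ (rEsharp2 : ℝ)),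
        ∃ (S SF : C0Semigroup ℂ (WcevenZ eight_pos))
          (hσ₀ : -((3 : ℝ) / 20 - ((DeltaE : ℚ) : ℝ) / 4) <
            (((‖((4 : ℂ) • innerSL ℂ (realE eight_pos liftEOfRecord (liftEOfRecord_mem_WevenZ eight_pos))).smulRight
                (realE eight_pos liftEOfRecord (liftEOfRecord_mem_WevenZ eight_pos))‖ : ℝ) : ℂ)).re),
          S.generator = generatorEven eight_pos _
              (gardingDataKE_star_of_centre isCentre_centreOfRecord hcs δ (fun _ => rfl) (gardingDataKE_ofRecord hS1) c2_le_fifth hu) _ hσ₀ ∧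
          (∀ τ : ℝ≥0, ‖S.app τ‖ ≤ Real.exp (-((3 : ℝ) / 20 - ((DeltaE : ℚ) : ℝ) / 4) * τ)) ∧
          (∀ σ : ℂ, -((3 : ℝ) / 20 - ((DeltaE : ℚ) : ℝ) / 4) < σ.re → ∀ G : WcevenZ eight_pos,
            S.laplaceResolventFun σ G = resolventEven eight_pos _
              (gardingDataKE_star_of_centre isCentre_centreOfRecord hcs δ (fun _ => rfl) (gardingDataKE_ofRecord hS1) c2_le_fifth hu) σ G) ∧
          ((SF.generator.domain : Set (WcevenZ eight_pos)) =
            (generatorEven eight_pos _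
              (gardingDataKE_star_of_centre isCentre_centreOfRecord hcs δ (fun _ => rfl) (gardingDataKE_ofRecord hS1) c2_le_fifth hu) _ hσ₀).domain) ∧
          (∀ (w : WcevenZ eight_pos) (hw : w ∈ (generatorEven eight_pos _
              (gardingDataKE_star_of_centre isCentre_centreOfRecord hcs δ (fun _ => rfl) (gardingDataKE_ofRecord hS1) c2_le_fifth hu) _ hσ₀).domain),
            ∃ hw' : w ∈ SF.generator.domain,
              SF.generator ⟨w, hw'⟩ = generatorEven eight_pos _
                  (gardingDataKE_star_of_centre isCentre_centreOfRecord hcs δ (fun _ => rfl) (gardingDataKE_ofRecord hS1) c2_le_fifth hu) _ hσ₀ ⟨w, hw⟩ +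
                ((4 : ℂ) * innerSL ℂ (realE eight_pos liftEOfRecord (liftEOfRecord_mem_WevenZ eight_pos)) w) •
                  realE eight_pos liftEOfRecord (liftEOfRecord_mem_WevenZ eight_pos)) ∧
          ∃ M : ℝ, ∀ (δ₀ : WcevenZ eight_pos) (t : ℝ), 0 ≤ t →
            ‖SF.app t.toNNReal δ₀ -
              ((deriv (evansEven eight_pos _
                    (gardingDataKE_star_of_centre isCentre_centreOfRecord hcs δ (fun _ => rfl) (gardingDataKE_ofRecord hS1) c2_le_fifth hu)
                    (innerSL ℂ (realE eight_pos liftEOfRecord (liftEOfRecord_mem_WevenZ eight_pos)))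
                    (realE eight_pos liftEOfRecord (liftEOfRecord_mem_WevenZ eight_pos)) 4) (1 / 2))⁻¹ *
                  ((4 : ℂ) * innerSL ℂ (realE eight_pos liftEOfRecord (liftEOfRecord_mem_WevenZ eight_pos))
                    (resolventEven eight_pos _
                      (gardingDataKE_star_of_centre isCentre_centreOfRecord hcs δ (fun _ => rfl) (gardingDataKE_ofRecord hS1) c2_le_fifth hu)
                      (1 / 2) δ₀)) * (Real.exp (t / 2) : ℂ)) •
                resolventEven eight_pos _
                  (gardingDataKE_star_of_centre isCentre_centreOfRecord hcs δ (fun _ => rfl) (gardingDataKE_ofRecord hS1) c2_le_fifth hu) (1 / 2)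
                  (realE eight_pos liftEOfRecord (liftEOfRecord_mem_WevenZ eight_pos))‖ ≤
              M * ‖δ₀‖ * Real.exp (-β' * t) := by
  haveI : CompleteSpace (WcevenZ eight_pos) := completeSpace_WcevenZ eight_pos
  obtain ⟨δ, ⟨hball, hlin⟩, huniq⟩ := existsUnique_weakSolution_ofRecord f ℓ Nmat hN₁ hN₂ hKNwB hepsNB hηB
  obtain ⟨Ωs₁, Hs, hcs, hweak, hne⟩ := exists_isCentre_star isCentre_centreOfRecord (contDiff_centreOfRecordDeriv (k := 1))
    integrable_weight_residual_sq_centreOfRecord δ hball hlin rEBR2_lt_abs_centreOfRecord_eight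
  have hδn : ‖δ‖ ≤ (rEBR2 : ℝ) := by rwa [mem_closedBall, dist_zero_right] at hball
  have hu : ‖δ‖ ≤ (rEsharp2 : ℝ) := hδn.trans rEBR2_le_rEsharp2
  exact ⟨δ, hball, hlin, fun δ' h1 h2 => huniq δ' ⟨h1, h2⟩, Ωs₁, Hs, hcs, hu,
    flow_stable_even_of_centre_of_smooth isCentre_centreOfRecord hcs δ (fun _ => rfl) (liftEOfRecord_mem_WevenZ eight_pos)
      (gardingDataKE_ofRecord hS1) c2_le_fifth c1_add_gamma_le hu hPD hFD (norm_sq_realE_liftEOfRecord_le eight_pos) hweak hne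
      contDiff_liftFunE liftFunE_neg integrable_liftFunE_and_integral.2 integrable_weight_liftFunE_sq
      integrable_weight_deriv_liftFunE_sq integrable_weight_mul_deriv_liftFunE_sq integrable_weight_deriv_deriv_liftFunE_sq
      liftEOfRecord_ae_and_norm.1 hβ' hβ'3⟩

end Word

end SheetRLinearisedStabilityEvenOfRecord
end Summit.NavierStokesRegularity.OSWSelfSimilar

end
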